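import Summits.BirchSwinnertonDyer.BirchSwinnertonDyer.Theorems.KolyvaginRoadThreePTDevissage
import Summits.BirchSwinnertonDyer.BirchSwinnertonDyer.Theorems.SchneiderFreeAdditiveX3PoitouTateShaTwoMu
import Summits.BirchSwinnertonDyer.BirchSwinnertonDyer.Theorems.SchneiderFreeAdditiveX3PoitouTateSelmerComplementCanonical
import Summits.BirchSwinnertonDyer.BirchSwinnertonDyer.Theorems.SchneiderFreeAdditiveX3PoitouTateUnramifiedOrthogonalAllLevels
import HarnessLib

/-!
# Dévissage of Milne I Thm. 4.10(b) — the statement for THE invariant maps, and the transport of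
# `Ш²(K, μₙ) = 0` to every module isomorphic to `μₙ`

* `middleExact_canonical_of_extension` — `middleExact_of_extension` for the family
  `LocalInvariants.canonical K n` (`K : Type`), its four structural hypotheses discharged by the tree:
  `canonical_isPerfect`, `canonical_injectiveAtRealPlaces`, `unramifiedOrthogonal_of_isPerfect_allLevels`,
  `sumLocalTermEqZero_canonical`.
* `galoisCohomology.map_two_twoCocycleClass`, `localization_map_two` — functoriality of `H²` in the module
  on explicit cocycles and its compatibility with localisation (degree-`2` twin of `res_map_one`).
* `sha_two_eq_zero_of_intertwining_mu` — **`Ш²(K, M) = 0` for every finite discrete module `M` admitting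
  intertwining maps `φ : M → μₙ`, `ψ : μₙ → M` with `ψ ∘ φ = id`** (e.g. `M ≅ μₙ`, or `M ≅ ℤ/n` when
  `μₙ ⊂ K`): the obstruction group `Ш²(K, M₁)` / `Ш²(K, M₃^D)` of the dévissage for pieces of that shape,
  from bsd-schneider's `galoisCohomology_mu_two_eq_zero_of_localization_eq_zero` (Brauer–Hasse–Noether +
  Hilbert 90).

Theorems only; no case of BSD.  References: [MilneADT2006] I Thm. 4.10; [SerreGaloisCohomology1997] I §2.4.
-/

noncomputable section

open CategoryTheory Function NumberField IsDedekindDomain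
open scoped NumberField ContRepresentation

universe u

set_option linter.dupNamespace false
set_option autoImplicit false

namespace Summit.BirchSwinnertonDyer.BirchSwinnertonDyer.Theorems.KolyvaginRoadThreePT

open Field
open Literature.NumberTheory.GaloisRepresentations Literature.NumberTheory.GaloisCohomology
open Literature.NumberTheory.GaloisRepresentations.DiscreteGaloisModule (mu MuCarrier TateDual tateDual
  localTatePairingZMod homOfIntertwining unramifiedSubgroup SelmerStructure)
open _root_.TopRep _root_.ContRepresentation _root_.ContinuousCohomology
open Summit.BirchSwinnertonDyer.BirchSwinnertonDyer.Theorems.SchneiderFreeAdditiveX3.PoitouTateReduction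

/-! ## §1. `H²` functoriality on cocycles and localisation -/

section DegreeTwo

variable {K : Type u} [Field K]
variable {M₁ M₂ : Type u}
  [AddCommGroup M₁] [TopologicalSpace M₁] [DiscreteTopology M₁]
  [AddCommGroup M₂] [TopologicalSpace M₂] [DiscreteTopology M₂]
variable {ρ₁ : DiscreteGaloisModule K M₁} {ρ₂ : DiscreteGaloisModule K M₂}

/-- `H²(φ) [c] = [φ ∘ c]` on continuous inhomogeneous `2`-cocycles (the instance argument is
`absoluteGaloisGroup_compactSpace K`). [cite: SerreGaloisCohomology1997, I §2.4] -/
theorem galoisCohomology.map_two_twoCocycleClass [CompactSpace (absoluteGaloisGroup K)]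
    (φ : ρ₁.toContRepresentation →ⁱL ρ₂.toContRepresentation) (c : contTwoCocycles ρ₁.toTopRep) :
    galoisCohomology.map φ 2 (twoCocycleClass ρ₁.toTopRep c) =
      twoCocycleClass ρ₂.toTopRep
        (contTwoCocycles.pullback (ContinuousMonoidHom.id (absoluteGaloisGroup K))
          (X := ρ₁.toTopRep) (Y := ρ₂.toTopRep)
          (TopRep.ofHom ⟨φ.toContinuousLinearMap, φ.isIntertwining'⟩) c) :=
  map_twoCocycleClass _ _ _ c

/-- `res_E [c] = [c ∘ (res × res)]` in degree `2`, for a field extension `E/K`.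
[cite: SerreGaloisCohomology1997, I §2.4] -/
theorem galoisCohomology.res_two_twoCocycleClass [CompactSpace (absoluteGaloisGroup K)]
    (E : Type u) [Field E] [Algebra K E] [CompactSpace (absoluteGaloisGroup E)]
    (c : contTwoCocycles ρ₁.toTopRep) :
    galoisCohomology.res ρ₁ E 2 (twoCocycleClass ρ₁.toTopRep c) =
      twoCocycleClass (DiscreteGaloisModule.toTopRep (GaloisRep.restrictField E ρ₁))
        (contTwoCocycles.pullback (absGaloisRestrict K E) (X := ρ₁.toTopRep)
          (Y := DiscreteGaloisModule.toTopRep (GaloisRep.restrictField E ρ₁))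
          (TopRep.ofHom ⟨ContinuousLinearMap.id ℤ M₁, fun _ => rfl⟩) c) :=
  map_twoCocycleClass _ _ _ c

/-- **Restriction commutes with the change of coefficients on `H²`**:
`res_E ∘ H²(φ) = H²(φ|_{Γ_E}) ∘ res_E`. [cite: SerreGaloisCohomology1997, I §2.4] -/
theorem galoisCohomology.res_map_two [CompactSpace (absoluteGaloisGroup K)]
    (E : Type u) [Field E] [Algebra K E] [CompactSpace (absoluteGaloisGroup E)]
    (φ : ρ₁.toContRepresentation →ⁱL ρ₂.toContRepresentation) (x : galoisCohomology ρ₁ 2) :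
    galoisCohomology.res ρ₂ E 2 (galoisCohomology.map φ 2 x) =
      galoisCohomology.map (φ.restrictField E) 2 (galoisCohomology.res ρ₁ E 2 x) := by
  obtain ⟨c, rfl⟩ := twoCocycleClass_surjective ρ₁.toTopRep x
  rw [galoisCohomology.map_two_twoCocycleClass, galoisCohomology.res_two_twoCocycleClass,
    galoisCohomology.res_two_twoCocycleClass, galoisCohomology.map_two_twoCocycleClass]
  rfl

/-- `H²(ψ) (H²(φ) x) = x` when `ψ ∘ φ = id`. [folklore] -/
theorem galoisCohomology.map_two_map_two_eq_self_of_comp_eq [CompactSpace (absoluteGaloisGroup K)]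
    (φ : ρ₁.toContRepresentation →ⁱL ρ₂.toContRepresentation)
    (ψ : ρ₂.toContRepresentation →ⁱL ρ₁.toContRepresentation) (hψφ : ∀ m : M₁, ψ (φ m) = m)
    (x : galoisCohomology ρ₁ 2) :
    galoisCohomology.map ψ 2 (galoisCohomology.map φ 2 x) = x := by
  obtain ⟨c, rfl⟩ := twoCocycleClass_surjective ρ₁.toTopRep x
  rw [galoisCohomology.map_two_twoCocycleClass, galoisCohomology.map_two_twoCocycleClass]
  refine congrArg _ (Subtype.ext (ContinuousMap.ext fun p => ?_))
  obtain ⟨σ, τ⟩ := p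
  exact hψφ _

end DegreeTwo

/-! ## §2. `Ш²(K, M) = 0` for `M` a retract of `μₙ` (e.g. `M ≅ μₙ`) -/

section ShaTwo

variable {K : Type} [Field K] [NumberField K] {n : ℕ} [NeZero n]
variable {M : Type} [AddCommGroup M] [TopologicalSpace M] [DiscreteTopology M]

/-- **`Ш²(K, M) = 0` whenever `M` is a retract of `μₙ` as a Galois module** (intertwining maps
`φ : M → μₙ`, `ψ : μₙ → M` with `ψ ∘ φ = id`; e.g. `M ≅ μₙ`, or `M ≅ ℤ/n` with `μₙ ⊂ K`): a class of
`H²(K, M)` vanishing at every place vanishes.  From `Ш²(K, μₙ) = 0` (Brauer–Hasse–Noether + Hilbert 90,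
bsd-schneider's `galoisCohomology_mu_two_eq_zero_of_localization_eq_zero`) and the compatibility of
`H²(φ)` with localisation.  This is the obstruction group of the dévissage (`middleExact_of_extension`,
hypotheses `hSha₁`, `hSha₃D`) for pieces of that shape. [cite: MilneADT2006, Ch. I, Thm. 4.10]
[cite: CasselsFrohlichANT1967, Ch. VII §9.6] -/
theorem sha_two_eq_zero_of_intertwining_mu (ρ : DiscreteGaloisModule K M)
    (φ : ρ.toContRepresentation →ⁱL (mu K n).toContRepresentation)
    (ψ : (mu K n).toContRepresentation →ⁱL ρ.toContRepresentation) (hψφ : ∀ m : M, ψ (φ m) = m)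
    (z : galoisCohomology ρ 2) (hz : ∀ v : Place K, galoisCohomology.localization ρ v 2 z = 0) :
    z = 0 := by
  haveI := absoluteGaloisGroup_compactSpace K
  have hx : galoisCohomology.map φ 2 z = 0 := by
    refine galoisCohomology_mu_two_eq_zero_of_localization_eq_zero _ (fun v => ?_) (fun w => ?_)
    · haveI := absoluteGaloisGroup_compactSpace (v.adicCompletion K)
      change galoisCohomology.res (mu K n) (v.adicCompletion K) 2 (galoisCohomology.map φ 2 z) = 0
      rw [galoisCohomology.res_map_two (v.adicCompletion K) φ z]
      have h0 : galoisCohomology.res ρ (v.adicCompletion K) 2 z = 0 := hz (Sum.inr v)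
      rw [h0, map_zero]
    · haveI := absoluteGaloisGroup_compactSpace (w.Completion)
      change galoisCohomology.res (mu K n) w.Completion 2 (galoisCohomology.map φ 2 z) = 0
      rw [galoisCohomology.res_map_two w.Completion φ z]
      have h0 : galoisCohomology.res ρ w.Completion 2 z = 0 := hz (Sum.inl w)
      rw [h0, map_zero]
  rw [← galoisCohomology.map_two_map_two_eq_self_of_comp_eq φ ψ hψφ z, hx, map_zero]

end ShaTwo

/-! ## §3. The dévissage for THE invariant maps -/

section Canonical

variable {K : Type} [Field K] [NumberField K] {n : ℕ} [NeZero n]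
variable {M₁ M₂ M₃ : Type}
  [AddCommGroup M₁] [TopologicalSpace M₁] [DiscreteTopology M₁] [Finite M₁]
  [AddCommGroup M₂] [TopologicalSpace M₂] [DiscreteTopology M₂] [Finite M₂]
  [AddCommGroup M₃] [TopologicalSpace M₃] [DiscreteTopology M₃] [Finite M₃]
variable {ρ₁ : DiscreteGaloisModule K M₁} {ρ₂ : DiscreteGaloisModule K M₂}
  {ρ₃ : DiscreteGaloisModule K M₃}

/-- **DÉVISSAGE OF MILNE I THM. 4.10(b) FOR THE INVARIANT MAPS** `LocalInvariants.canonical K n`: the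
statement of `middleExact_of_extension` with the four structural properties of the family discharged
(`canonical_isPerfect`, `canonical_injectiveAtRealPlaces`, Milne I 2.6 `unramifiedOrthogonal_of_isPerfect_allLevels`,
reciprocity `sumLocalTermEqZero_canonical`).  So `hE(canonical K n)(M₂, S)` follows from `hE` for `M₁` (all
`S' ⊇ S`), `M₃` (`S`), `M₃^D` (all `S' ⊇ S`), `Ш²(K, M₁) = 0`, `Ш²(K, M₃^D) = 0`, and the vanishing of the
classes of `M₁^D`, `M₃^{DD}` trivial on `S` and unramified off `S`.
[cite: MilneADT2006, Ch. I, Thm. 4.10(b)] [cite: Howard2004HeegnerKolyvagin, Thm. 2.1.11 (arXiv:1202.6340 p. 6)] -/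
theorem middleExact_canonical_of_extension [Finite (TateDual K M₃ n)]
    {f : ρ₁.toContRepresentation →ⁱL ρ₂.toContRepresentation}
    {g : ρ₂.toContRepresentation →ⁱL ρ₃.toContRepresentation}
    (h : IsSES (homOfIntertwining f) (homOfIntertwining g))
    (hM₁ : ∀ m : M₁, n • m = 0) (hM₂ : ∀ m : M₂, n • m = 0)
    (gD : (ρ₃.tateDual n).toContRepresentation →ⁱL (ρ₂.tateDual n).toContRepresentation)
    (hgD : ∀ (φ : TateDual K M₃ n) (m : M₂), gD φ m = φ (g m))
    (fD : (ρ₂.tateDual n).toContRepresentation →ⁱL (ρ₁.tateDual n).toContRepresentation)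
    (hfD : ∀ (φ : TateDual K M₂ n) (m : M₁), fD φ m = φ (f m))
    {S : Finset (Place K)} (hSinf : ∀ w : InfinitePlace K, (Sum.inl w : Place K) ∈ S)
    (hS : ∀ v : HeightOneSpectrum (𝓞 K), (Sum.inr v : Place K) ∉ S →
      ((n : ℕ) : 𝓞 K) ∉ v.asIdeal ∧ GaloisRep.IsUnramifiedAt v ρ₁ ∧ GaloisRep.IsUnramifiedAt v ρ₂ ∧
        GaloisRep.IsUnramifiedAt v ρ₃)
    (hE₁ : ∀ S' : Finset (Place K), S ⊆ S' →
      ∀ t : Π v : Place K, galoisCohomology (ρ₁.toLocal v) 1,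
        (∀ y : galoisCohomology (ρ₁.tateDual n) 1,
          (∀ v : HeightOneSpectrum (𝓞 K), (Sum.inr v : Place K) ∉ S' →
            galoisCohomology.localization (ρ₁.tateDual n) (Sum.inr v) 1 y ∈
              unramifiedSubgroup (GaloisRep.toLocal v (ρ₁.tateDual n)) 1) →
          ∑ v ∈ S', localTatePairingZMod ρ₁ n v (LocalInvariants.canonical K n v) (t v)
            (galoisCohomology.localization (ρ₁.tateDual n) v 1 y) = 0) →
        ∃ x : galoisCohomology ρ₁ 1,
          (∀ v : HeightOneSpectrum (𝓞 K), (Sum.inr v : Place K) ∉ S' →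
            galoisCohomology.localization ρ₁ (Sum.inr v) 1 x ∈
              unramifiedSubgroup (GaloisRep.toLocal v ρ₁) 1) ∧
          ∀ v ∈ S', galoisCohomology.localization ρ₁ v 1 x = t v)
    (hE₃ : ∀ t : Π v : Place K, galoisCohomology (ρ₃.toLocal v) 1,
        (∀ y : galoisCohomology (ρ₃.tateDual n) 1,
          (∀ v : HeightOneSpectrum (𝓞 K), (Sum.inr v : Place K) ∉ S →
            galoisCohomology.localization (ρ₃.tateDual n) (Sum.inr v) 1 y ∈
              unramifiedSubgroup (GaloisRep.toLocal v (ρ₃.tateDual n)) 1) →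
          ∑ v ∈ S, localTatePairingZMod ρ₃ n v (LocalInvariants.canonical K n v) (t v)
            (galoisCohomology.localization (ρ₃.tateDual n) v 1 y) = 0) →
        ∃ x : galoisCohomology ρ₃ 1,
          (∀ v : HeightOneSpectrum (𝓞 K), (Sum.inr v : Place K) ∉ S →
            galoisCohomology.localization ρ₃ (Sum.inr v) 1 x ∈
              unramifiedSubgroup (GaloisRep.toLocal v ρ₃) 1) ∧
          ∀ v ∈ S, galoisCohomology.localization ρ₃ v 1 x = t v)
    (hE₃D : ∀ S' : Finset (Place K), S ⊆ S' →
      ∀ t : Π v : Place K, galoisCohomology ((ρ₃.tateDual n).toLocal v) 1,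
        (∀ y : galoisCohomology ((ρ₃.tateDual n).tateDual n) 1,
          (∀ v : HeightOneSpectrum (𝓞 K), (Sum.inr v : Place K) ∉ S' →
            galoisCohomology.localization ((ρ₃.tateDual n).tateDual n) (Sum.inr v) 1 y ∈
              unramifiedSubgroup (GaloisRep.toLocal v ((ρ₃.tateDual n).tateDual n)) 1) →
          ∑ v ∈ S', localTatePairingZMod (ρ₃.tateDual n) n v (LocalInvariants.canonical K n v) (t v)
            (galoisCohomology.localization ((ρ₃.tateDual n).tateDual n) v 1 y) = 0) →
        ∃ x : galoisCohomology (ρ₃.tateDual n) 1,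
          (∀ v : HeightOneSpectrum (𝓞 K), (Sum.inr v : Place K) ∉ S' →
            galoisCohomology.localization (ρ₃.tateDual n) (Sum.inr v) 1 x ∈
              unramifiedSubgroup (GaloisRep.toLocal v (ρ₃.tateDual n)) 1) ∧
          ∀ v ∈ S', galoisCohomology.localization (ρ₃.tateDual n) v 1 x = t v)
    (hSha₁ : ∀ z : galoisCohomology ρ₁ 2,
      (∀ v : Place K, galoisCohomology.localization ρ₁ v 2 z = 0) → z = 0)
    (hSha₃D : ∀ z : galoisCohomology (ρ₃.tateDual n) 2,
      (∀ v : Place K, galoisCohomology.localization (ρ₃.tateDual n) v 2 z = 0) → z = 0)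
    (hH₁ : ∀ y : galoisCohomology (ρ₁.tateDual n) 1,
      (∀ v ∈ S, galoisCohomology.localization (ρ₁.tateDual n) v 1 y = 0) →
      (∀ v : HeightOneSpectrum (𝓞 K), (Sum.inr v : Place K) ∉ S →
        galoisCohomology.localization (ρ₁.tateDual n) (Sum.inr v) 1 y ∈
          unramifiedSubgroup (GaloisRep.toLocal v (ρ₁.tateDual n)) 1) → y = 0)
    (hH₃D : ∀ y : galoisCohomology ((ρ₃.tateDual n).tateDual n) 1,
      (∀ v ∈ S, galoisCohomology.localization ((ρ₃.tateDual n).tateDual n) v 1 y = 0) →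
      (∀ v : HeightOneSpectrum (𝓞 K), (Sum.inr v : Place K) ∉ S →
        galoisCohomology.localization ((ρ₃.tateDual n).tateDual n) (Sum.inr v) 1 y ∈
          unramifiedSubgroup (GaloisRep.toLocal v ((ρ₃.tateDual n).tateDual n)) 1) → y = 0)
    (t : Π v : Place K, galoisCohomology (ρ₂.toLocal v) 1)
    (horth : ∀ y : galoisCohomology (ρ₂.tateDual n) 1,
      (∀ v : HeightOneSpectrum (𝓞 K), (Sum.inr v : Place K) ∉ S →
        galoisCohomology.localization (ρ₂.tateDual n) (Sum.inr v) 1 y ∈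
          unramifiedSubgroup (GaloisRep.toLocal v (ρ₂.tateDual n)) 1) →
      ∑ v ∈ S, localTatePairingZMod ρ₂ n v (LocalInvariants.canonical K n v) (t v)
        (galoisCohomology.localization (ρ₂.tateDual n) v 1 y) = 0) :
    ∃ x : galoisCohomology ρ₂ 1,
      (∀ v : HeightOneSpectrum (𝓞 K), (Sum.inr v : Place K) ∉ S →
        galoisCohomology.localization ρ₂ (Sum.inr v) 1 x ∈ unramifiedSubgroup (GaloisRep.toLocal v ρ₂) 1) ∧
      ∀ v ∈ S, galoisCohomology.localization ρ₂ v 1 x = t v :=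
  middleExact_of_extension (LocalInvariants.canonical K n) LocalInvariants.canonical_isPerfect
    LocalInvariants.canonical_injectiveAtRealPlaces
    (unramifiedOrthogonal_of_isPerfect_allLevels _ LocalInvariants.canonical_isPerfect)
    (sumLocalTermEqZero_canonical n) h hM₁ hM₂ gD hgD fD hfD hSinf hS hE₁ hE₃ hE₃D hSha₁ hSha₃D hH₁ hH₃D
    t horth

end Canonical

end Summit.BirchSwinnertonDyer.BirchSwinnertonDyer.Theorems.KolyvaginRoadThreePT

end
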